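import Literature.IUT.HodgeArakelov.EtaleThetaDataOfSetting

/-!
# Cofinality for [IUTchII] Prop. 1.4's `lim_J H¹(Π_Ÿ(Π)|_J, ·)` at the model `Π := Π^tp_X̲̲`:
# every open `Π^tp_X̲̲`-normal subgroup of finite index in `Π^tp_Ÿ̲̲` is `Π^tp_Ÿ̲̲ ∩ J` for a finite-index open `J`

S. Mochizuki, *Inter-universal Teichmüller theory II*, kurims manuscript (Dec. 2020), Prop. 1.4 p. 27:
"`J` ranges over the finite index open subgroups of `Π`" and the modules are `H¹(Π_Ÿ(Π)|_J, (l·Δ_Θ)(Π))`,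
"`|_J` denotes the fiber product `×_Π J`" (Cor. 1.12 (a) p. 56) [claim: Mochizuki2012, status: disputed]. At the
model (`EtaleThetaDataOfSetting.lean`, abc-iut-L6-t1) `Π = Π^tp_X̲̲ = C.Huu` and `Π_Ÿ(Π) = Π^tp_Ÿ̲̲ = Π^tp_Ÿ ∩ Π^tp_X̲̲`
has INFINITE index in `Π^tp_X̲̲` ("`Π^tp_X̲̲/Π^tp_Ÿ̲̲ ≅ (l·ℤ) × μ₂`", [EtTh] Def. 2.7 p. 41; L2-t8's `DoubleUnderline.toLZ`,
`relIndex_GtpYdd_inf`). The subgroups `Π^tp_Ÿ̲̲ ∩ J`, `J` finite-index open in `Π^tp_X̲̲`, are therefore NOT all the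
finite-index open subgroups of `Π^tp_Ÿ̲̲`; this proof-only file (abc-iut-w5-d187, node IUTchII:Prop2.2(ii), row
Prop-22.ii.r13a input "hdiv") shows they are exactly the ones NORMALISED BY `Π^tp_X̲̲` up to cofinality:

* `exists_finiteIndex_open_inf_eq_of_le_ker` — if `N₀ ≤ Π^tp_Ÿ̲̲` is normal in `Π^tp_X̲̲`, open, and of finite
  index in `Ker(Π^tp_X̲̲ ↠ ℤ) = Π^tp_Y̲̲`, then `N₀ = Π^tp_Ÿ̲̲ ∩ J` for the finite-index open `J := N₀ · ⟨h₀⟩`, `h₀ ↦ 1`;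
* `exists_finiteIndex_open_inf_eq` — the same with "finite index in `Π^tp_Ÿ̲̲`" under `K = K̈` (`Sec2Hyps`,
  `[Π^tp_Y̲̲ : Π^tp_Ÿ̲̲] = 2`).

Elementary group theory over L2-t8's `toLZ` ([EtTh] Def. 2.13 (i) p. 47 "`Gal(Y̲̲/X̲̲) (≅ l·ℤ)`"); no definitions,
nothing of [EtTh]/[IUTchII] asserted; no side taken on [IUTchIII] Cor. 3.12.
-/

namespace Literature.IUT.HodgeArakelov

open Literature.AnabelianGeometry.EtaleTheta EtaleThetaDataOfSetting

noncomputable section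

namespace EtaleThetaDataOfSetting

variable {p : ℕ} [Fact p.Prime] {D : Literature.AnabelianGeometry.EtaleTheta.ThetaSetting p}
  {E : D.EtaleThetaData} {l : ℕ} (C : E.DoubleUnderline l)

/-- `Π^tp_Ÿ̲̲ ⊆ Π^tp_Y̲̲ = Ker(Π^tp_X̲̲ ↠ ℤ)` (`Π^tp_Ÿ ⊆ Π^tp_Y`). [cite: MochizukiEtTh2009, Def 2.13 (i) p.47] -/
theorem piYdd_le_ker_toLZ : PiYdd C ≤ C.toLZ.ker := by
  intro x hx
  rw [C.toLZ_ker, Subgroup.mem_subgroupOf]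
  have hx' : ((x : Pi C) : D.PiTemp) ∈ C.GtpYdduu := Subgroup.mem_subgroupOf.mp hx
  exact D.GtpYdd_le_GtpY (Subgroup.mem_inf.mp hx').1

/-- **Cofinality** (kernel form): an open subgroup `N₀ ≤ Π^tp_Ÿ̲̲` which is normal in `Π^tp_X̲̲` and of finite index
in `Π^tp_Y̲̲ = Ker(Π^tp_X̲̲ ↠ ℤ)` is `Π^tp_Ÿ̲̲ ∩ J` for some finite-index open `J ≤ Π^tp_X̲̲` — namely `J = N₀ · ⟨h₀⟩` with
`h₀ ↦ 1 ∈ ℤ` (`toLZ_surjective`): `J` is open as it contains `N₀`, of finite index because `Π^tp_Y̲̲` surjects onto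
`Π^tp_X̲̲/J`, and `Π^tp_Ÿ̲̲ ∩ J = N₀` because `Π^tp_Ÿ̲̲ ⊆ Ker`. [cite: MochizukiEtTh2009, Def 2.13 (i) p.47] -/
theorem exists_finiteIndex_open_inf_eq_of_le_ker (N₀ : Subgroup (Pi C)) [hN : N₀.Normal]
    (hle : N₀ ≤ PiYdd C) (hopen : IsOpen (N₀ : Set (Pi C)))
    (hfi : (N₀.subgroupOf C.toLZ.ker).FiniteIndex) :
    ∃ J : Subgroup (Pi C), J.FiniteIndex ∧ IsOpen (J : Set (Pi C)) ∧ PiYdd C ⊓ J = N₀ := by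
  obtain ⟨h₀, hh₀⟩ := C.toLZ_surjective (Multiplicative.ofAdd 1)
  let J : Subgroup (Pi C) := N₀ ⊔ Subgroup.zpowers h₀
  have hNJ : N₀ ≤ J := le_sup_left
  have hh₀J : h₀ ∈ J := Subgroup.mem_sup_right (Subgroup.mem_zpowers h₀)
  -- every element is `y * h₀ ^ k` with `y ∈ Ker toLZ`
  have hdecomp : ∀ x : Pi C, ∃ k : ℤ, x * (h₀ ^ k)⁻¹ ∈ C.toLZ.ker := by
    intro x
    refine ⟨Multiplicative.toAdd (C.toLZ x), ?_⟩
    rw [MonoidHom.mem_ker, map_mul, map_inv, map_zpow, hh₀, ← ofAdd_zsmul, smul_eq_mul, mul_one,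
      ofAdd_toAdd, mul_inv_cancel]
  -- members of `J` lying in the kernel lie in `N₀`
  have hJker : ∀ x : Pi C, x ∈ J → x ∈ C.toLZ.ker → x ∈ N₀ := by
    intro x hxJ hxk
    have hxJ' : x ∈ ((N₀ ⊔ Subgroup.zpowers h₀ : Subgroup (Pi C)) : Set (Pi C)) := hxJ
    rw [Subgroup.normal_mul] at hxJ'
    obtain ⟨n, hn, z, hz, rfl⟩ := Set.mem_mul.mp hxJ'
    obtain ⟨k, rfl⟩ := Subgroup.mem_zpowers_iff.mp hz
    have hnk : n ∈ C.toLZ.ker := piYdd_le_ker_toLZ C (hle hn)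
    have hk : h₀ ^ k ∈ C.toLZ.ker := by
      have := (C.toLZ.ker).mul_mem ((C.toLZ.ker).inv_mem hnk) hxk
      rwa [inv_mul_cancel_left] at this
    rw [MonoidHom.mem_ker, map_zpow, hh₀, ← ofAdd_zsmul, smul_eq_mul, mul_one, ofAdd_eq_one] at hk
    rw [hk, zpow_zero, mul_one]
    exact hn
  refine ⟨J, ?_, Subgroup.isOpen_mono hNJ hopen, ?_⟩
  · -- finite index: `Ker toLZ ↠ Π/J` factors through the finite `Ker / N₀`
    haveI := hfi
    haveI : Finite (C.toLZ.ker ⧸ N₀.subgroupOf C.toLZ.ker) := Subgroup.finite_quotient_of_finiteIndex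
    let f : C.toLZ.ker ⧸ N₀.subgroupOf C.toLZ.ker → Pi C ⧸ J :=
      Quotient.lift (fun y : C.toLZ.ker => (QuotientGroup.mk (y : Pi C) : Pi C ⧸ J)) (by
        intro a b hab
        apply QuotientGroup.eq.mpr
        have hab' : a⁻¹ * b ∈ N₀.subgroupOf C.toLZ.ker := QuotientGroup.leftRel_apply.mp hab
        exact hNJ (Subgroup.mem_subgroupOf.mp hab'))
    have hf : Function.Surjective f := by
      intro q
      induction q using QuotientGroup.induction_on with
      | H x =>
        obtain ⟨k, hk⟩ := hdecomp x
        refine ⟨Quotient.mk _ ⟨x * (h₀ ^ k)⁻¹, hk⟩, ?_⟩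
        change (QuotientGroup.mk (x * (h₀ ^ k)⁻¹) : Pi C ⧸ J) = QuotientGroup.mk x
        apply QuotientGroup.eq.mpr
        rw [mul_inv_rev, inv_inv, mul_assoc, inv_mul_cancel, mul_one]
        exact J.zpow_mem hh₀J k
    haveI : Finite (Pi C ⧸ J) := Finite.of_surjective f hf
    exact Subgroup.finiteIndex_of_finite_quotient
  · refine le_antisymm ?_ (le_inf hle hNJ)
    intro x hx
    exact hJker x (Subgroup.mem_inf.mp hx).2 (piYdd_le_ker_toLZ C (Subgroup.mem_inf.mp hx).1)

/-- `[Π^tp_Y̲̲ : Π^tp_Ÿ̲̲] = 2` inside `Π^tp_X̲̲` under `K = K̈` (L2-t8's `relIndex_GtpYdd_inf`, transported along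
`Π^tp_X̲̲ ↪ Π^tp_X`). [cite: MochizukiEtTh2009, Def 2.7 p.41] -/
theorem relIndex_piYdd_ker_toLZ (hS : D.Sec2Hyps) : (PiYdd C).relIndex C.toLZ.ker = 2 := by
  rw [C.toLZ_ker]
  change (C.GtpYdduu.subgroupOf C.Huu).relIndex (D.GtpY.subgroupOf C.Huu) = 2
  have h1 : (C.GtpYdduu.subgroupOf C.Huu).relIndex (D.GtpY.subgroupOf C.Huu) =
      (C.GtpYdduu.subgroupOf C.Huu).relIndex ((C.Huu ⊓ D.GtpY).subgroupOf C.Huu) := by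
    congr 1
    ext x
    simp only [Subgroup.mem_subgroupOf, Subgroup.mem_inf, SetLike.coe_mem, true_and]
  rw [h1, Subgroup.relIndex_subgroupOf inf_le_left]
  have h2 : C.GtpYdduu.relIndex (C.Huu ⊓ D.GtpY) = D.GtpYdd.relIndex (C.Huu ⊓ D.GtpY) := by
    rw [Subgroup.relIndex, Subgroup.relIndex]
    congr 1
    ext x
    simp only [Subgroup.mem_subgroupOf, Subgroup.mem_inf]
    exact ⟨fun h => h.1, fun h => ⟨h, (Subgroup.mem_inf.mp x.2).1⟩⟩
  rw [h2]
  exact C.relIndex_GtpYdd_inf hS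

/-- **Cofinality**: under `K = K̈`, an open subgroup `N₀ ≤ Π^tp_Ÿ̲̲` which is normal in `Π^tp_X̲̲` and of finite
index in `Π^tp_Ÿ̲̲` is `Π^tp_Ÿ̲̲ ∩ J` for some finite-index open `J ≤ Π^tp_X̲̲`; so such `N₀` are cofinal among the
indices of [IUTchII] Prop. 1.4's `lim_J H¹(Π_Ÿ(Π)|_J, ·)` at the model. [claim: Mochizuki2012, status: disputed]
(IUTchII §1 Prop 1.4, kurims p.27) -/
theorem exists_finiteIndex_open_inf_eq (hS : D.Sec2Hyps) (N₀ : Subgroup (Pi C)) [N₀.Normal]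
    (hle : N₀ ≤ PiYdd C) (hopen : IsOpen (N₀ : Set (Pi C)))
    (hfi : (N₀.subgroupOf (PiYdd C)).FiniteIndex) :
    ∃ J : Subgroup (Pi C), J.FiniteIndex ∧ IsOpen (J : Set (Pi C)) ∧ PiYdd C ⊓ J = N₀ := by
  refine exists_finiteIndex_open_inf_eq_of_le_ker C N₀ hle hopen ⟨?_⟩
  -- `[Ker : N₀] = [Ker : Π^tp_Ÿ̲̲] · [Π^tp_Ÿ̲̲ : N₀] = 2 · [Π^tp_Ÿ̲̲ : N₀] ≠ 0`
  change N₀.relIndex C.toLZ.ker ≠ 0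
  rw [← Subgroup.relIndex_mul_relIndex N₀ (PiYdd C) C.toLZ.ker hle (piYdd_le_ker_toLZ C),
    relIndex_piYdd_ker_toLZ C hS]
  exact mul_ne_zero hfi.1 two_ne_zero

end EtaleThetaDataOfSetting

end

end Literature.IUT.HodgeArakelov
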